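import Summits.NavierStokesRegularity.NavierStokesRegularity.Theses.AxisymmetricExtremality
import Literature.Analysis.FluidPDE.RusinSverakCompactnessHolds
import Literature.Analysis.FluidPDE.HomSobolevRepresentedL3
import HarnessLib

/-!
# Crux `PFoldToAxisymmetric` (stmt-NavierStokesRegularity-15454), line `birth`, stub 1
# `stub_compactModuloSim`: Rusin–Šverák compactness modulo `Sim`, full strength, `L³` form

Support file (theorems only, `--supports stmt-NavierStokesRegularity-15454`).

For `ν > 0`, every sequence `(U k, G k)` of `Ḣ^{1/2}`-minimal blow-up data
(`Literature.Analysis.FluidPDE.IsMinimalBlowupDatum`) admits scales `lam j > 0`, centres `x₀ j`, a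
subsequence `φ` and a minimal blow-up datum `(u, g)` such that the modulated data
`x ↦ lam j • U (φ j) (lam j • x - x₀ j)` converge to `u` in `L³(ℝ³)`.

This is Rusin–Šverák, J. Funct. Anal. 260 (2011) = arXiv:0911.0500, Cor. 4.3 (p. 8; with §1 p. 3:
"the set of minimal data is compact modulo scalings and translations"), and it is assembled from
the tree:

* `rusin_sverak_minimal_data_subseq_limit_of_weak_limit_blowup` (`RusinSverakMinimalData.lean`)
  fed with the discharged PDE leaf `rusin_sverak_weak_limit_blowup_holds`
  (`RusinSverakCompactnessHolds.lean`) gives the modulated sequence, again in `M`, with a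
  subsequence of classes converging in `Ḣ^{1/2}` to a class representing a minimal datum;
* `HomSobolev.Represents.sub` and `exists_const_eLpNorm_three_le_of_represents_complexify`
  (`HomSobolevRepresentedL3.lean`, Bahouri–Chemin–Danchin 2011 Thm. 1.38) turn `Ḣ^{1/2}`
  convergence of the classes into `L³` convergence of the represented real fields:
  `‖v_j - u‖_{L³} ≤ C ‖g'_j - g‖_{Ḣ^{1/2}} → 0`.

References: W. Rusin, V. Šverák, J. Funct. Anal. 260 (2011) 879–891 = arXiv:0911.0500, Cor. 4.3
[RusinSverak2011]; H. Bahouri, J.-Y. Chemin, R. Danchin, *Fourier Analysis and Nonlinear PDE*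
(2011), Thm. 1.38 [BahouriCheminDanchin2011].
-/

noncomputable section

-- the summit and its single sub-problem share the name (CONVENTIONS §1), as in every Theorems file
set_option linter.dupNamespace false

namespace Summit.NavierStokesRegularity.NavierStokesRegularity.Theorems.PFoldToAxisymmetric.CompactModuloSim

open MeasureTheory Filter Topology
open scoped ENNReal NNReal

/-- **`Ḣ^{1/2}`-distance of classes controls the `L³`-distance of the represented real fields.**
With the constant `C` of `‖u₀‖_{L³} ≤ C ‖g‖_{Ḣ^{1/2}}`
(`exists_const_eLpNorm_three_le_of_represents_complexify`): if `g` represents `complexify ∘ v` and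
`g'` represents `complexify ∘ v'`, then `‖v - v'‖_{L³} ≤ C ‖g - g'‖`, because `g - g'` represents
`complexify ∘ (v - v')` (`Represents.sub`, linearity of `complexify`).
[cite: BahouriCheminDanchin2011, Thm. 1.38 (d = 3, s = 1/2)] -/
theorem eLpNorm_three_sub_le_of_represents {C : ℝ≥0}
    (hC : ∀ (u₀ : EuclideanSpace ℝ (Fin 3) → EuclideanSpace ℝ (Fin 3))
      (g : Literature.Analysis.FunctionSpaces.HomSobolev (EuclideanSpace ℝ (Fin 3))
        (EuclideanSpace ℂ (Fin 3)) (1 / 2 : ℝ)),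
      g.Represents (Literature.Analysis.FunctionSpaces.EuclideanSpace.complexify ∘ u₀) →
        eLpNorm u₀ 3 volume ≤ C * ‖g‖ₑ)
    {v v' : EuclideanSpace ℝ (Fin 3) → EuclideanSpace ℝ (Fin 3)}
    {g g' : Literature.Analysis.FunctionSpaces.HomSobolev (EuclideanSpace ℝ (Fin 3))
      (EuclideanSpace ℂ (Fin 3)) (1 / 2 : ℝ)}
    (hg : g.Represents (Literature.Analysis.FunctionSpaces.EuclideanSpace.complexify ∘ v))
    (hg' : g'.Represents (Literature.Analysis.FunctionSpaces.EuclideanSpace.complexify ∘ v')) :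
    eLpNorm (v - v') 3 volume ≤ C * ‖g - g'‖ₑ := by
  refine hC (v - v') (g - g') ?_
  have hfun : Literature.Analysis.FunctionSpaces.EuclideanSpace.complexify ∘ (v - v') =
      Literature.Analysis.FunctionSpaces.EuclideanSpace.complexify ∘ v -
        Literature.Analysis.FunctionSpaces.EuclideanSpace.complexify ∘ v' := by
    funext x
    simp only [Function.comp_apply, Pi.sub_apply, map_sub]
  rw [hfun]
  exact hg.sub hg'

/-- **Stub 1 (Rusin–Šverák compactness modulo `Sim`, full strength, `L³` form).** For `ν > 0`, every
sequence of `Ḣ^{1/2}`-minimal blow-up data `(U k, G k)` admits scales `lam j > 0`, centres `x₀ j`, a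
subsequence `φ` and a minimal blow-up datum `(u, g)` such that the modulated data
`x ↦ lam j • U (φ j) (lam j • x - x₀ j)` converge to `u` in `L³`.
[cite: RusinSverak2011, Cor. 4.3 (arXiv:0911.0500 p. 8)] -/
theorem stub_compactModuloSim :
    ∀ ν : ℝ, 0 < ν →
    ∀ (U : ℕ → EuclideanSpace ℝ (Fin 3) → EuclideanSpace ℝ (Fin 3))
      (G : ℕ → Literature.Analysis.FunctionSpaces.HomSobolev (EuclideanSpace ℝ (Fin 3))
        (EuclideanSpace ℂ (Fin 3)) (1 / 2 : ℝ)),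
      (∀ k, Literature.Analysis.FluidPDE.IsMinimalBlowupDatum ν (U k) (G k)) →
      ∃ (lam : ℕ → ℝ) (x₀ : ℕ → EuclideanSpace ℝ (Fin 3)) (φ : ℕ → ℕ)
        (u : EuclideanSpace ℝ (Fin 3) → EuclideanSpace ℝ (Fin 3))
        (g : Literature.Analysis.FunctionSpaces.HomSobolev (EuclideanSpace ℝ (Fin 3))
          (EuclideanSpace ℂ (Fin 3)) (1 / 2 : ℝ)),
        (∀ j, 0 < lam j) ∧ StrictMono φ ∧
        Literature.Analysis.FluidPDE.IsMinimalBlowupDatum ν u g ∧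
        Tendsto (fun j => eLpNorm
          (Literature.Analysis.FluidPDE.rescaleData (lam j) (fun x => U (φ j) (x - x₀ j)) - u)
          3 volume) atTop (𝓝 0) := by
  intro ν hν U G hM
  obtain ⟨lam, x₀, g', hlam, hmin, hsub⟩ :=
    Literature.Analysis.FluidPDE.rusin_sverak_minimal_data_subseq_limit_of_weak_limit_blowup
      Literature.Analysis.FluidPDE.rusin_sverak_weak_limit_blowup_holds hν U G hM
  obtain ⟨φ, v₀, glim, hφ, hv₀, htend⟩ := hsub id strictMono_id
  refine ⟨fun j => lam (φ j), fun j => x₀ (φ j), φ, v₀, glim, fun j => hlam (φ j), hφ, hv₀, ?_⟩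
  obtain ⟨C, hC⟩ :=
    Literature.Analysis.FluidPDE.exists_const_eLpNorm_three_le_of_represents_complexify
  have hbound : ∀ j, eLpNorm
      (Literature.Analysis.FluidPDE.rescaleData (lam (φ j)) (fun x => U (φ j) (x - x₀ (φ j))) - v₀)
        3 volume ≤ C * ‖g' (φ j) - glim‖ₑ := fun j =>
    eLpNorm_three_sub_le_of_represents hC (hmin (φ j)).2.1 hv₀.2.1
  have hclass : Tendsto (fun j => ‖g' (φ j) - glim‖ₑ) atTop (𝓝 0) := by
    have h := (htend.sub_const glim).enorm
    simpa only [id, sub_self, enorm_zero] using h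
  have hmul : Tendsto (fun j => (C : ℝ≥0∞) * ‖g' (φ j) - glim‖ₑ) atTop (𝓝 0) := by
    simpa only [mul_zero] using ENNReal.Tendsto.const_mul hclass (Or.inr ENNReal.coe_ne_top)
  exact tendsto_of_tendsto_of_tendsto_of_le_of_le tendsto_const_nhds hmul (fun _ => bot_le)
    hbound

end Summit.NavierStokesRegularity.NavierStokesRegularity.Theorems.PFoldToAxisymmetric.CompactModuloSim

end
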